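import Literature.MathematicalPhysics.QuantumFieldTheory.Balaban1983to89.B9Thm313WholeDirInputBCZCut

/-!
# `Balaban1983to89.B9Thm313WholeGGInputsMembers` — T. Bałaban, *Propagators for lattice gauge theories in a background field*, Commun. Math. Phys. **99** (1985)
# 389–434 [`Balaban1985BackgroundPropagators`], Theorem 3.13 p. 426 (row 21): the INPUT-HÖLDER lines (3.44) ∕ (3.45) of 𝔊 = G₁𝔓\* on the pair family AT THE
# G₁-MEMBER LINE — the (3.153) engine with outer factors (E, F) fed with the G₁-level pieces `E(G₁F)`, `E(G₁D)`, `E(G₁Q\*)` and the right entry `G₁F : sup → 𝔠⁽¹⁾` as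
# HYPOTHESES (free constants; `G₁F` read out of the input class itself, so NO class transfer and no multiplicity factor), then packaged on the pair family; NO step `G₀(Δ′_π + Δ⁽²⁾_π)` on a raw sup class is consumed

[4] = T. Bałaban, *Propagators and renormalization transformations for lattice gauge theories. II*, Commun. Math. Phys. **96** (1984) 223–250 [`Balaban1984PropagatorsII`].
statement-level skeleton of published theorems with citation tags; proofs where landed; nothing here is a claim about the Yang–Mills mass gap.

THE PRINT.  Thm 3.13 p. 426 (𝔊 satisfies (3.44)–(3.45) from (3.152)–(3.153), Theorem 3.12 and the estimates for G′, R); (3.44)–(3.45) p. 398 (the twice-differentiated words out of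
the Hölder input *"(‖λ‖_ε + |λ|)"*); (3.39)–(3.40) p. 397; Thm 3.12 p. 423.

WHY THIS FILE (cell `pub-ymgap`, node N06, bundle F7 rows 20–21, seat dag-n06-l g27; programme P-U8S step S5c).  The landed input readers
(`B9Thm313WholeDirInputBCZCut.GG_input_of_piecesFC_cut ∕ GG_input44m∕45m_cut_of_lettersBC`, `…CutFamily`) derive the G₁-level pieces INSIDE from `Step.step1` (`hK1 hK2`),
`StepDirB.sDd1 ∕ pXd1 ∕ tDd1` and `Letters313IM.tDv` on the raw classes — LOCATED-U8′ species.  Over the REGULAR state the pieces come from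
`B9Thm312WholeMembersRegular.input44∕45_of_stateS` (+ the right entries INTO 𝔖₁ and the state fields); so THIS FILE re-issues the engine and the family packaging CUT AT THE
G₁-MEMBER LINE:
* ★★ `GG_input_of_piecesF_members` — `GG_input_of_piecesFC_cut` with the right entry `G₁F : bA → 𝔠⁽¹⁾` (A₁, rate r) a HYPOTHESIS (in place of `hK1 + he2F` + the class
  transfer): `HasMaj bA bC (E∘(𝔊∘F)) ((K₄₄ + κ_P K_D B_r c + K_Q(B₃(B₃A₁c)c)c)·e^{−ρ₄d})`;
* ★★ `GG_input44Family_of_members` ∕ ★★ `GG_input45Family_of_members` — the (3.44) ∕ (3.45) lines of 𝔊 on the pair family `q ↦ ∇_{U,q.1}∘𝔊∘∇\*_{U,q.2}` from the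
  per-pair G₁-level pieces (∀ q: `E_q(G₁∇\*_{q.2})` out of `bHX ε`, `E_q(G₁D)` out of `bHW ε`, `E_q(G₁Q\*)` out of `Z_{len·w}`, `G₁∇\*_{q.2} : bHX ε → 𝔠⁽¹⁾`; E_q = ∇_{q.1}
  resp. Φ^X_β∘∇_{q.1} into `𝔠_P^{(β)}`), by §1 and `hasMaj_familyOp'` (`sliceProbe_comp_familyOp`, `hasMaj_unweight_out` for (3.45)).
HONEST SCOPE.  Letter algebra over hypothesis schemas of printed species; every analytic member is a HYPOTHESIS; nothing of [B9]∕[4] asserted; no pin, no certificate edit;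
COUNT-NEUTRAL; N06 NOT discharged; nothing continuum ∕ OS positivity ∕ mass gap.  Cell `pub-ymgap` (HUMAN RULING D-0062), Track A node N06 [B9], seat `pub-ymgap-dag-n06-l` (g27),
2026-08-29.  NEW file; nothing landed is modified.
-/

namespace Literature.MathematicalPhysics.QuantumFieldTheory.Balaban1983to89.B9Thm313WholeGGInputsMembers

open Literature.MathematicalPhysics.QuantumFieldTheory.Balaban1983to89
open Finset B6RandomWalk B6RandomWalkHom B9Thm34Ext B9Thm37GlueCor36 B11SectG B9SectDSup
open B9Thm37AllNorms B9Thm37AllNormsInstances B9Thm312Whole B9Thm312WholeLeaf B9Thm312WholeLeft B9Thm313Whole B9Thm313WholeLeft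
open B9RWSums343Holder B9Ineq347 B9Thm312WholeClasses B9Thm312WholeHolder B9Thm312WholeHHolder B9Thm313WholeHolder B9Thm313WholeInput
open B9RWSums346SecondDiff B9RWSums344InputFam B9Thm312WholeDir B9Thm313WholeDir B9Thm313WholeDirInput B9Thm312WholeDirB
open B9Thm313WholeDirInputB B9Thm313WholeZ B9Thm313WholeLeftZ B9Thm313WholeHolderZ B9Thm313WholeInputZ B9Thm313WholeDirZ
open B9Thm313WholeDirInputZ B9Thm313WholeDirInputBZ B9Thm313WholeInputC B9Thm313WholeDirInputBC B9Thm313WholeDirInputBCZCut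
open B9BlockNormClassTransfer

noncomputable section

section OneMember

variable {g : B9.Geometry} {B : B9.Backgrounds} {X Y Z W PX PY P : Type}
variable [Fintype X] [Fintype Y] [Fintype Z] [Fintype W] [Fintype PX] [Fintype PY] [Fintype P] [Fintype g.Site]
variable {R₀ : ℝ} {H₀ : Prop}

/-! ## §1 (3.153) with outer factors E, F at the G₁-member line -/

omit [Fintype Y] [Fintype P] in
/-- ★★ **(3.153) WITH OUTER FACTORS (E, F), CLASS-LOCALISED INPUT, AT THE G₁-MEMBER LINE** (`GG_input_of_piecesFC_cut` with the right entry `G₁F : ofBlocks blkV → 𝔠⁽¹⁾`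
a HYPOTHESIS `h2A` out of the input class `bA` itself — over the regular state: the producer `G₀F : bA → 𝔖₁`, `StepS`, the sup reading): E(𝔊F) = E(G₁F) − E(G₁D)(RD\*G₁F) −
E(G₁Q\*)((QG₁Q\*)⁻¹Q(G₁F)) with the three E-pieces (`hGop hGD hGQ`), the letters `rgdd`-type (`hRG`), `q1`, `c1_1`:
`HasMaj bA bC (E∘(𝔊∘F)) ((K₄₄ + κ_P K_D B_r c + K_Q(B₃(B₃A₁c)c)c)·e^{−ρ₄d})`, ρ₄ + 2σ ≦ ρ₂ ≦ r, ρ₂ + σ ≦ δ₃.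
[cite: Balaban1985BackgroundPropagators, Thm 3.13 p.426 + (3.153) p.426 + (3.44)–(3.45) p.398 + (3.132) p.422; Balaban1984PropagatorsII, (2.52) p.232, Lemma 2.1 (2.61) p.234] -/
theorem GG_input_of_piecesF_members (hG : GeoOK g) {𝔬 : Ops g B X Y Z W} {U : B.Cfg} {P' V : Type} [Fintype V]
    {F : (V → ℝ) →ₗ[ℝ] (X → ℝ)}
    {bA : BlockNorm (toB6 g R₀ H₀) (V → ℝ)} {bP : BlockNorm (toB6 g R₀ H₀) (W → ℝ)} {bC : BlockNorm (toB6 g R₀ H₀) (P' → ℝ)}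
    {E : (X → ℝ) →ₗ[ℝ] (P' → ℝ)} {A₁ B₃ Br K44 KD KQ δ₃ r ρ₂ ρ₄ σ c : ℝ}
    (hrow : RowSum (toB6 g R₀ H₀) σ c) (hc : 0 ≤ c) (hA₁ : 0 ≤ A₁) (hB₃ : 0 ≤ B₃) (hBr : 0 ≤ Br) (hK44 : 0 ≤ K44)
    (hKD : 0 ≤ KD) (hKQ : 0 ≤ KQ) (hσ : 0 ≤ σ) (hρ₄ : 0 ≤ ρ₄) (hρ₄₂ : ρ₄ + 2 * σ ≤ ρ₂) (hρ₂r : ρ₂ ≤ r) (hρ₂₃ : ρ₂ + σ ≤ δ₃)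
    (h2A : HasMaj bA (cNorm R₀ H₀ 𝔬.blk hG.lenle 1) (𝔬.G1 U ∘ₗ F) (fun a b => A₁ * Real.exp (-(r * g.dist a b))))
    (wZ : g.Site → ℝ) (hwZ : ∀ y, 0 < wZ y)
    (hLq1 : HasMaj (cNorm R₀ H₀ 𝔬.blk hG.lenle 1) (cNorm R₀ H₀ 𝔬.blkZ hG.lenle 1) (𝔬.Q U) (fun a b => B₃ * Real.exp (-(δ₃ * g.dist a b))))
    (hLc1_1 : HasMaj (cNorm R₀ H₀ 𝔬.blkZ hG.lenle 1)
      (weightNorm (BlockNorm.ofBlocks (toB6 g R₀ H₀) 𝔬.blkZ) (fun y => g.len y * wZ y) fun y => (wZlen_pos hG hwZ y).le) (𝔬.C1 U)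
      (fun a b => B₃ * Real.exp (-(δ₃ * g.dist a b)))) (hI : Identities 𝔬 U)
    (hRG : HasMaj bA bP (𝔬.R U ∘ₗ 𝔬.Dvstar U ∘ₗ 𝔬.G1 U ∘ₗ F) (fun a b => Br * Real.exp (-(δ₃ * g.dist a b))))
    (hGop : HasMaj bA bC (E ∘ₗ (𝔬.G1 U ∘ₗ F)) (fun a b => K44 * Real.exp (-(ρ₂ * g.dist a b))))
    (hGD : HasMaj bP bC (E ∘ₗ (𝔬.G1 U ∘ₗ 𝔬.Dv U)) (fun a b => KD * Real.exp (-(ρ₂ * g.dist a b))))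
    (hGQ : HasMaj (weightNorm (BlockNorm.ofBlocks (toB6 g R₀ H₀) 𝔬.blkZ) (fun y => g.len y * wZ y) fun y => (wZlen_pos hG hwZ y).le) bC
      (E ∘ₗ 𝔬.G1 U ∘ₗ 𝔬.Qstar U) (fun a b => KQ * Real.exp (-(ρ₂ * g.dist a b)))) :
    HasMaj bA bC (E ∘ₗ (𝔬.GG U ∘ₗ F))
      (fun a b => (K44 + bP.κ * KD * Br * c + KQ * (B₃ * (B₃ * A₁ * c) * c) * c) * Real.exp (-(ρ₄ * g.dist a b))) := by
  -- `GG_input_of_piecesFC_cut` below the member line (no class transfer: `G₁F` is read out of the input class itself)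
  have htri : Triangle254 (toB6 g R₀ H₀) := fun a b c => hG.tri a b c
  have hρ₂0 : 0 ≤ ρ₂ := by linarith
  have hρ₂₃' : ρ₂ ≤ δ₃ := by linarith
  have hQG : HasMaj bA (cNorm R₀ H₀ 𝔬.blkZ hG.lenle 1) (𝔬.Q U ∘ₗ (𝔬.G1 U ∘ₗ F))
      (fun a b => (cNorm R₀ H₀ 𝔬.blk hG.lenle 1 (X := X)).κ * B₃ * A₁ * c *
        Real.exp (-(ρ₂ * g.dist a b))) :=
    hasMaj_comp_exp htri hG.dnn hrow hB₃ hA₁ hρ₂0 hρ₂r hρ₂₃ hLq1 h2A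
  simp only [cNorm_κ, one_mul] at hQG
  -- C₁ : Z^{(1)} → Z_{len·wZ}
  have hC : HasMaj (cNorm R₀ H₀ 𝔬.blkZ hG.lenle 1) (weightNorm (BlockNorm.ofBlocks (toB6 g R₀ H₀) 𝔬.blkZ) (fun y => g.len y * wZ y) fun y => (wZlen_pos hG hwZ y).le)
      (𝔬.C1 U) (fun a b => B₃ * Real.exp (-(δ₃ * g.dist a b))) := hLc1_1
  have hBQ0 : 0 ≤ B₃ * A₁ * c := mul_nonneg (mul_nonneg hB₃ hA₁) hc
  -- (3.153) composed
  have hfr := hasMaj_frakG_classes htri hG.dnn hrow hK44 hKD hBr hKQ hB₃ hBQ0 hρ₄ hσ hρ₄₂ hGop hGD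
    (hRG.of_rate_le hG.dnn hBr hρ₂₃') hGQ (hC.of_rate_le hG.dnn hB₃ hρ₂₃') hQG
  have hGG := hfr.congr (T' := E ∘ₗ (𝔬.GG U ∘ₗ F)) fun μ => by rw [E_GG_F_eq hI E F]
  refine hGG.mono fun a b => le_of_eq ?_
  simp only [cNorm_κ, weightNorm_ofBlocks_κ, one_mul, toB6_dist]


/-! ## §2 (3.44), (3.45) for 𝔊 on the pair family at the G₁-member line -/

omit [Fintype Y] in
/-- ★★ **THE (3.44) LINE OF 𝔊 ON THE PAIR FAMILY AT THE G₁-MEMBER LINE**: from the per-pair pieces `∇_{q.1}(G₁∇\*_{q.2}) : bHX ε → sup` (K₄₄), `∇_{q.1}(G₁D) : bHW ε → sup` (K_D),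
`∇_{q.1}(G₁Q\*) : Z_{len·w} → sup` (K_Q) at the rate ρ₂ and the right entries `G₁∇\*_{q.2} : sup → 𝔠⁽¹⁾` (A₁, r), the letters `rgdd q.2` (RD\*G₁∇\*_{q.2} : bHX ε → bHW ε, B_r, δ₃),
`q1`, `c1_1`: `HasMaj (bHX ε) (ofBlocks (blk ∘ fst)) (familyOp (q ↦ ∇_{q.1}∘𝔊∘∇\*_{q.2})) (K·e^{−ρ₄d})`, `K = K₄₄ + κ_W K_D B_r c + K_Q(B₃(B₃A₁c)c)c` — the input `h44` of
`ineq343_345_of_majorants_pairM`.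
[cite: Balaban1985BackgroundPropagators, Thm 3.13 p.426 + (3.153) p.426 + (3.44) p.398 + (3.39) p.397] -/
theorem GG_input44Family_of_members (hG : GeoOK g) {𝔬 : Ops g B X Y Z W} {U : B.Cfg}
    {Dd Dds : B.Cfg → P → Module.End ℝ (X → ℝ)} {bHXε : BlockNorm (toB6 g R₀ H₀) (X → ℝ)} {bHWε : BlockNorm (toB6 g R₀ H₀) (W → ℝ)}
    {A₁ B₃ Br K44 KD KQ δ₃ r ρ₂ ρ₄ σ c : ℝ}
    (hrow : RowSum (toB6 g R₀ H₀) σ c) (hc : 0 ≤ c) (hA₁ : 0 ≤ A₁) (hB₃ : 0 ≤ B₃) (hBr : 0 ≤ Br) (hK44 : 0 ≤ K44)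
    (hKD : 0 ≤ KD) (hKQ : 0 ≤ KQ) (hσ : 0 ≤ σ) (hρ₄ : 0 ≤ ρ₄) (hρ₄₂ : ρ₄ + 2 * σ ≤ ρ₂) (hρ₂r : ρ₂ ≤ r) (hρ₂₃ : ρ₂ + σ ≤ δ₃)
    (h2A : ∀ μ : P, HasMaj bHXε (cNorm R₀ H₀ 𝔬.blk hG.lenle 1) (𝔬.G1 U ∘ₗ Dds U μ) (fun a b => A₁ * Real.exp (-(r * g.dist a b))))
    (wZ : g.Site → ℝ) (hwZ : ∀ y, 0 < wZ y)
    (hLq1 : HasMaj (cNorm R₀ H₀ 𝔬.blk hG.lenle 1) (cNorm R₀ H₀ 𝔬.blkZ hG.lenle 1) (𝔬.Q U) (fun a b => B₃ * Real.exp (-(δ₃ * g.dist a b))))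
    (hLc1_1 : HasMaj (cNorm R₀ H₀ 𝔬.blkZ hG.lenle 1)
      (weightNorm (BlockNorm.ofBlocks (toB6 g R₀ H₀) 𝔬.blkZ) (fun y => g.len y * wZ y) fun y => (wZlen_pos hG hwZ y).le) (𝔬.C1 U)
      (fun a b => B₃ * Real.exp (-(δ₃ * g.dist a b)))) (hI : Identities 𝔬 U)
    (hRG : ∀ μ : P, HasMaj bHXε bHWε (𝔬.R U ∘ₗ 𝔬.Dvstar U ∘ₗ 𝔬.G1 U ∘ₗ Dds U μ) (fun a b => Br * Real.exp (-(δ₃ * g.dist a b))))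
    (hGop : ∀ q : P × P, HasMaj bHXε (BlockNorm.ofBlocks (toB6 g R₀ H₀) 𝔬.blk) (Dd U q.1 ∘ₗ (𝔬.G1 U ∘ₗ Dds U q.2))
      (fun a b => K44 * Real.exp (-(ρ₂ * g.dist a b))))
    (hGD : ∀ ν : P, HasMaj bHWε (BlockNorm.ofBlocks (toB6 g R₀ H₀) 𝔬.blk) (Dd U ν ∘ₗ (𝔬.G1 U ∘ₗ 𝔬.Dv U))
      (fun a b => KD * Real.exp (-(ρ₂ * g.dist a b))))
    (hGQ : ∀ ν : P, HasMaj (weightNorm (BlockNorm.ofBlocks (toB6 g R₀ H₀) 𝔬.blkZ) (fun y => g.len y * wZ y) fun y => (wZlen_pos hG hwZ y).le)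
      (BlockNorm.ofBlocks (toB6 g R₀ H₀) 𝔬.blk) (Dd U ν ∘ₗ 𝔬.G1 U ∘ₗ 𝔬.Qstar U) (fun a b => KQ * Real.exp (-(ρ₂ * g.dist a b)))) :
    HasMaj bHXε (BlockNorm.ofBlocks (toB6 g R₀ H₀) (𝔬.blk ∘ Prod.fst))
      (familyOp (fun q : P × P => Dd U q.1 ∘ₗ (𝔬.GG U ∘ₗ Dds U q.2)))
      (fun (a b : g.Site) => (K44 + bHWε.κ * KD * Br * c + KQ * (B₃ * (B₃ * A₁ * c) * c) * c) * Real.exp (-(ρ₄ * g.dist a b))) := by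
  have hK0 : 0 ≤ K44 + bHWε.κ * KD * Br * c + KQ * (B₃ * (B₃ * A₁ * c) * c) * c := by
    have hκ := bHWε.κ_nonneg
    positivity
  exact hasMaj_familyOp' (R := R₀) (H := H₀) 𝔬.blk (fun a b => mul_nonneg hK0 (Real.exp_nonneg _))
    fun q => GG_input_of_piecesF_members hG hrow hc hA₁ hB₃ hBr hK44 hKD hKQ hσ hρ₄ hρ₄₂ hρ₂r hρ₂₃ (h2A q.2) wZ hwZ hLq1 hLc1_1 hI
      (hRG q.2) (hGop q) (hGD q.1) (hGQ q.1)

omit [Fintype Y] [Fintype PY] in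
/-- ★★ **THE (3.45) LINE OF 𝔊 ON THE PAIR FAMILY AT THE G₁-MEMBER LINE**: as `GG_input44Family_of_members` with the outer factor `Φ^X_β∘∇_{q.1}` INTO the weighted probe class
`𝔠_P^{(β)}` (pieces `K₄₅ K_D K_Q` at the rate ρ₂, out of `bHX (β+ε)`, `bHW (β+ε)`, `Z_{len·w}`), unweighted at the end (`hasMaj_unweight_out`):
`HasMaj (bHX (β+ε)) (ofBlocks (blkPX ∘ fst)) (sliceProbe Φ^X_β ∘ familyOp (q ↦ ∇_{q.1}∘𝔊∘∇\*_{q.2})) (K·(Lʲη)^{−β}·e^{−ρ₄d})` — the input `h45` of `ineq343_345_of_majorants_pairM`.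
[cite: Balaban1985BackgroundPropagators, Thm 3.13 p.426 + (3.153) p.426 + (3.45) p.398 + (3.39)–(3.40) p.397] -/
theorem GG_input45Family_of_members (hG : GeoOK g) (𝔭 : HolderProbes g B X Y PX PY) {𝔬 : Ops g B X Y Z W} {U : B.Cfg}
    {Dd Dds : B.Cfg → P → Module.End ℝ (X → ℝ)} {bHXε : BlockNorm (toB6 g R₀ H₀) (X → ℝ)} {bHWε : BlockNorm (toB6 g R₀ H₀) (W → ℝ)}
    {A₁ B₃ Br K45 KD KQ β δ₃ r ρ₂ ρ₄ σ c : ℝ}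
    (hrow : RowSum (toB6 g R₀ H₀) σ c) (hc : 0 ≤ c) (hA₁ : 0 ≤ A₁) (hB₃ : 0 ≤ B₃) (hBr : 0 ≤ Br) (hK45 : 0 ≤ K45)
    (hKD : 0 ≤ KD) (hKQ : 0 ≤ KQ) (hσ : 0 ≤ σ) (hρ₄ : 0 ≤ ρ₄) (hρ₄₂ : ρ₄ + 2 * σ ≤ ρ₂) (hρ₂r : ρ₂ ≤ r) (hρ₂₃ : ρ₂ + σ ≤ δ₃)
    (h2A : ∀ μ : P, HasMaj bHXε (cNorm R₀ H₀ 𝔬.blk hG.lenle 1) (𝔬.G1 U ∘ₗ Dds U μ) (fun a b => A₁ * Real.exp (-(r * g.dist a b))))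
    (wZ : g.Site → ℝ) (hwZ : ∀ y, 0 < wZ y)
    (hLq1 : HasMaj (cNorm R₀ H₀ 𝔬.blk hG.lenle 1) (cNorm R₀ H₀ 𝔬.blkZ hG.lenle 1) (𝔬.Q U) (fun a b => B₃ * Real.exp (-(δ₃ * g.dist a b))))
    (hLc1_1 : HasMaj (cNorm R₀ H₀ 𝔬.blkZ hG.lenle 1)
      (weightNorm (BlockNorm.ofBlocks (toB6 g R₀ H₀) 𝔬.blkZ) (fun y => g.len y * wZ y) fun y => (wZlen_pos hG hwZ y).le) (𝔬.C1 U)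
      (fun a b => B₃ * Real.exp (-(δ₃ * g.dist a b)))) (hI : Identities 𝔬 U)
    (hRG : ∀ μ : P, HasMaj bHXε bHWε (𝔬.R U ∘ₗ 𝔬.Dvstar U ∘ₗ 𝔬.G1 U ∘ₗ Dds U μ) (fun a b => Br * Real.exp (-(δ₃ * g.dist a b))))
    (hGop : ∀ q : P × P, HasMaj bHXε (cNormR R₀ H₀ 𝔭.blkPX hG.lenle β) ((𝔭.ΦX U β ∘ₗ Dd U q.1) ∘ₗ (𝔬.G1 U ∘ₗ Dds U q.2))
      (fun a b => K45 * Real.exp (-(ρ₂ * g.dist a b))))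
    (hGD : ∀ ν : P, HasMaj bHWε (cNormR R₀ H₀ 𝔭.blkPX hG.lenle β) ((𝔭.ΦX U β ∘ₗ Dd U ν) ∘ₗ (𝔬.G1 U ∘ₗ 𝔬.Dv U))
      (fun a b => KD * Real.exp (-(ρ₂ * g.dist a b))))
    (hGQ : ∀ ν : P, HasMaj (weightNorm (BlockNorm.ofBlocks (toB6 g R₀ H₀) 𝔬.blkZ) (fun y => g.len y * wZ y) fun y => (wZlen_pos hG hwZ y).le)
      (cNormR R₀ H₀ 𝔭.blkPX hG.lenle β) ((𝔭.ΦX U β ∘ₗ Dd U ν) ∘ₗ 𝔬.G1 U ∘ₗ 𝔬.Qstar U) (fun a b => KQ * Real.exp (-(ρ₂ * g.dist a b)))) :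
    HasMaj bHXε (BlockNorm.ofBlocks (toB6 g R₀ H₀) (𝔭.blkPX ∘ Prod.fst))
      (sliceProbe (𝔭.ΦX U β) ∘ₗ familyOp (fun q : P × P => Dd U q.1 ∘ₗ (𝔬.GG U ∘ₗ Dds U q.2)))
      (fun (a b : g.Site) => (K45 + bHWε.κ * KD * Br * c + KQ * (B₃ * (B₃ * A₁ * c) * c) * c) * g.len a ^ (-β) *
        Real.exp (-(ρ₄ * g.dist a b))) := by
  have hK0 : 0 ≤ K45 + bHWε.κ * KD * Br * c + KQ * (B₃ * (B₃ * A₁ * c) * c) * c := by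
    have hκ := bHWε.κ_nonneg
    positivity
  rw [sliceProbe_comp_familyOp]
  refine hasMaj_familyOp' (R := R₀) (H := H₀) 𝔭.blkPX
    (fun a b => mul_nonneg (mul_nonneg hK0 (Real.rpow_nonneg (hG.lenle a) _)) (Real.exp_nonneg _)) fun q => ?_
  have h := GG_input_of_piecesF_members hG hrow hc hA₁ hB₃ hBr hK45 hKD hKQ hσ hρ₄ hρ₄₂ hρ₂r hρ₂₃ (h2A q.2) wZ hwZ hLq1 hLc1_1 hI
    (hRG q.2) (hGop q) (hGD q.1) (hGQ q.1)
  have hu := hasMaj_unweight_out hG h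
  exact (hu.congr (T' := 𝔭.ΦX U β ∘ₗ Dd U q.1 ∘ₗ 𝔬.GG U ∘ₗ Dds U q.2) fun μ => rfl).mono fun a b => le_of_eq (by ring)

end OneMember

end

end Literature.MathematicalPhysics.QuantumFieldTheory.Balaban1983to89.B9Thm313WholeGGInputsMembers
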